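import Literature.MathematicalPhysics.QuantumFieldTheory.Balaban1983to89.B8Thm2TorusServerP3
import Literature.MathematicalPhysics.QuantumFieldTheory.Balaban1983to89.B8Thm2TorusSock142159
import Literature.MathematicalPhysics.QuantumFieldTheory.Balaban1983to89.B8SpecialLinearTrace
import Literature.MathematicalPhysics.QuantumFieldTheory.Balaban1983to89.B7AvgClosedSpecialUnitarySharp

/-!
# `Balaban1983to89.B8Thm2TorusAtOfLetters` — [Balaban1985RegularSpaces] Theorem 2 (p. 83) ON THE TORUS `T_η`, BOTH HALVES, FOR A
# `G`-VALUED PAIR (`G ≤ U(𝔸)` averaging-closed with a trace-like `τ`; `G = SU(N)`, `N ≤ 25`): the interface of record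
# `B8Thm2TorusAt.Thm2TorusAt L k P η 0 B₁ B₂ c₁ len G (fun _ => True)` SUPPLIED, member-uniformly, MODULO THE [4] LETTERS — route P's
# endpoint of sub-row «G-B8-T2S» (all six sockets of `B8Thm2TorusSupplier.Thm2TorusSockets` served from the letters, ONE threshold)

statement-level skeleton of published theorems with citation tags; proofs where landed; nothing here is a claim about the
Yang–Mills mass gap

T. Bałaban, *Spaces of regular gauge field configurations on a lattice and gauge fixing conditions*, Commun. Math. Phys. **99** (1985)
75–102 `[Balaban1985RegularSpaces]` ("B8"): Thm 2 p. 83 with (1.33)–(1.39) pp. 82–83, Thm 4 p. 88, Prop. 5 p. 94, p. 95, (1.42) p. 83, (1.59)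
p. 86, (1.65)–(1.66) p. 87, p. 77 («Ω_j = T_η»), p. 76 (`G = SU(N)`); T. Bałaban, *Propagators for lattice gauge theories in a background field*,
Commun. Math. Phys. **99** (1985) 389–434 `[Balaban1985BackgroundPropagators]` ("[4]"): Thms 3.1–3.3 pp. 397–399 (the letters).  STATUS:
published, refereed.

CITATION HEADER (lean-in-tree rule).  Cell `lit-balaban`, seat `lit-balaban-t2s-1` (gen 2), sub-row «G-B8-T2S» (R3 `stmt-QuantumFields-19200`,
`--supports`, helper), route P layer L4 (endpoint).  WHAT IS REPRODUCED.  Print's proof of Theorem 2 (pp. 82–89, 94–95) is the tree's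
`B8Thm2TorusSupplier.thm2TorusAt_of_sockets` (gen 0) MODULO the six sockets `Thm2TorusSockets` (Prop. 5 base ∕ step ∕ uniqueness, (1.42) twice,
(1.59)) and the windows `Thm2TorusWindows`.  This file serves ALL SIX SOCKETS at one `G`-valued `P`-periodic pair from the [4] letters at the
background `U₀` (every truncation `≤ k`; `B8Thm2TorusLetters.LettersAllP`, the `τ`-laws `LettersAllPTau`), the in-edge b9 socket
`B8LeafModelZd3.SockB9P3` (every truncation) and the J-SU group data, with ONE threshold `c₀` depending on `d, L` and the letters' constants only:
* §1 **`serverWindows_threshold`** — the bookkeeping «for α₀ + α₁ sufficiently small» (p. 95): one `c₀ > 0` below which the three window families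
  (`B8SockHFPWindows.hfpWindows_of_guard` at `(α₀, α₁ᵉ)`, `B8SockP5uEWindows.uniqWindows_of_guard` at `2B₀` at `(α₀, α₁ᵉ)` and at `(α₀, α₁′)`,
  `5dLB₀(α₀ + α₁′) = B₁(α₀ + α₁)`), Theorem 2's windows, the b9 thresholds and `α₄ < c_u` are all met (`α₁ᵉ = 11d²α₀ + α₁` of (1.66)).
* §2 ★ **`thm2TorusSockets_of_lettersAt`** — `Thm2TorusSockets L k P η 0 B₀ (2B₀) (8B₀′·5dLB₀) c_u B₁ len G α₀ α₁ U₀ U′` at explicit windows: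
  conjuncts 1–2 by `B8Thm2TorusServerP3.sockP5Base_of_lettersAt_u ∕ sockP5Step_of_lettersAt_u` run at the renamed `α₁ ↦ α₁ᵉ` of Theorem 4
  (p. 88; the all-levels closeness (1.66) by `B8Thm2TorusSock142159.h135_allLevels`, the (1.36) exponent of `U′` at the base by (1.65) and
  `B8Thm4TruncationLocal.base_datum`), conjuncts 3–5 by `B8Thm2TorusSock142159.sock142_of135 ∕ sock142_top ∕ sock159_of_sockB9P3` at the guard
  `2Lc⋆ + 8α₄`, conjunct 6 by `B8Thm2TorusServerP3.sockP5Uniq_of_lettersAt` at `c_A = B₁(α₀ + α₁)`.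
* §3 ★ **`thm2TorusSockets_uniform_of_letters`** — the consumer's shape (a) (ym-ust-19200-w1): `∃ c_u c₀ > 0` (from `d, L`, the letters'
  constants, `B₁`; NOT from `k, P, η`) with Theorem 2's windows below `c₀` AND, at every torus member `(k ≥ 1, P ∈ Lᵏℤ, η > 0)` carrying the
  letters, the six sockets for every `α₀ + α₁ ≤ c₀` and every admissible pair; ★ **`thm2TorusAt_uniform_of_letters`** — ONE pair `B₂, c₁ > 0` with
  `Thm2TorusAt L k P η 0 B₁ B₂ c₁ len G (fun _ => True)` at every such member (`B₁ > 5dLB₀(1 + 11d²)` free, p. 89 «at least for B₁ not too small»).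
* §4 ★ **`thm2TorusSockets_specialUnitary_of_letters`**, ★ **`thm2TorusAt_specialUnitary_of_letters`** — `G = SU(N)`, `1 ≤ N ≤ 25`, `𝔸 = M_N(ℂ)`
  with the operator norm, `τ = tr` (`B8SpecialUnitaryTrace.trCLM`), `H = SL(N, ℂ)` (`B13Inv214OrbitSUN.slUnits`): the endpoint consumed by
  `B8Thm2SetupTorus.thm2SetupSUAt_of_thm2TorusAt` (`N = 2` on R3).

## HONEST SCOPE
(i) Compositions of landed engines; Proposition 5, (1.42), (1.59) and [4] are NOT re-proved here.  REMAINING HYPOTHESES, displayed: the [4]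
letters `LettersAllP … cL η k P G` at the member (Green's functions `G′`, `H′`, `C⁻¹`, … with laws (U1)–(U3), (E1)–(E15) at every `G`-valued
`P`-periodic background of the class — v2 binder: the laws are read at arbitrary, not only periodic, ARGUMENTS; lead RULING #4 (v3) is NOT
implemented), their `τ`-laws `LettersAllPTau`, the b9 socket `SockB9P3` at every truncation (all unitary backgrounds of the class on `ℤᵈ`), the
free-constant condition `3·(2dL²)·B_G·B_R ≤ B₀′`, `5dLB₀ ≥ 2`, `B₁ > 5dLB₀(1 + 11d²)`, `P ∈ Lᵏℤ`, `d, L ≥ 2`.  (ii) Hölder datum `β₀ = 0`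
(`B₂(0)`), as in route K.  (iii) Count-neutral: N05 ∕ `stub_PV3A` is NOT discharged by this file (its consumer still owes the letters); Theorem 2 on
`T_η` is a theorem MODULO THE LETTERS; nothing continuum ∕ ℝ⁴ ∕ OS ∕ mass-gap ∕ Clay — the Yang–Mills mass gap is NOT proved.  No `sorry`, no `def`,
no `… : Prop` fact, no `instance`, no `notation`.
-/

noncomputable section

open NormedSpace
open scoped BigOperators

namespace Literature.MathematicalPhysics.QuantumFieldTheory.Balaban1983to89.B8Thm2TorusAtOfLetters

open Complex (I)
open MatrixLog (mlog)
open B7Prop1Explicit B7Prop2Explicit B7Prop1Local B7Eq92Concrete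
open B7Prop2Explicit (C0 c2')
open B7Prop3Flat (c3)
open B7Prop10General (C6 C4G)
open B7Prop9Flat (C5')
open B8Ineq132 (InAk)
open B8Eq119TwistedAxial (InAx)
open B8Eq184Proof (gaugeExp cfgExp)
open B8Lemma1NonAbelian (mulCfg)
open B8Ineq125Concrete (C2p)
open B8LeafModelZd3 (SockB9P3)
open B8Prop5ContractionKLevel (Mc Kc)
open B8Eq133Hypotheses (Hyp135)
open B12Ineq417Flat (shiftCfg)
open B8Thm4TorusAt (torusLam)
open B8Thm2TorusMember (torusLamb)
open B8Thm2TorusAt (Thm2TorusAt)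
open B8Thm2TorusLetters (LettersAt LettersTau LettersAllP LettersAllPTau)
open B8Thm2TorusSupplier (Thm2TorusSockets Thm2TorusWindows alpha1e cstarT alpha4T guardT apply_add_of_shiftCfg norm_sub_one_le_torus
  thm2TorusAt_of_sockets thm2TorusWindows_threshold)
open B8Thm2TorusSock142159 (inAx_torusLam_all h135_allLevels sock142_of135 sock142_top sock159_of_sockB9P3)
open B8Thm2TorusServerP3 (sockP5Step_of_lettersAt_u sockP5Base_of_lettersAt_u sockP5Uniq_of_lettersAt)
open B8SockHFPWindows (hfpWindows_of_guard)
open B8SockP5uEWindows (uniqWindows_of_guard)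
open B8Thm4TruncationLocal (base_datum)

-- `Site` alone could resolve to the torus sites of `Setup.lean`; re-export the `ℤ^d` sites of `B7Prop1Explicit`.
export B7Prop1Explicit (Site)

variable {d : ℕ}

/-! ## §1 The threshold «for α₀ + α₁ sufficiently small» (p. 95) -/

section Threshold

/-- **ONE THRESHOLD FOR THE SERVER'S WINDOWS** («for α₀ + α₁ sufficiently small», p. 95; «B₁ not too small», p. 89): for positive thresholds
`cP₁` (the JOIN windows), `cP₂` (the uniqueness windows), `c_u` (the radius of (1.109)), `c_w` (Theorem 2's windows), `c_L`, `c_B9` (the letters' and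
the b9 thresholds) and the constants `B₀, B₀′ > 0`, `B₁ ≥ 0` there is `c₀ > 0` such that `α₀ + α₁ ≤ c₀` puts `(α₀, α₁ᵉ)` below `cP₁`, `cP₂`,
`(α₀, α₁′)` (`5dLB₀(α₀ + α₁′) = B₁(α₀ + α₁)`) below `cP₂`, `α₄ = 8B₀′·5dLB₀·(α₀ + α₁ᵉ) < c_u`, the guard `2Lc⋆ + 8α₄ ≤ c_B9`, `α₀ ≤ c_L`,
`α₀ + α₁ ≤ c_w` — every quantity being linear in `α₀ + α₁` after `α₀ + α₁ᵉ ≤ (1 + 11d²)(α₀ + α₁)` ((1.66) p. 87).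
[cite: Balaban1985RegularSpaces, p.95 («for α₀ + α₁ sufficiently small»), (1.66) p.87, p.89 («at least for B₁ not too small»)] -/
theorem serverWindows_threshold (hd : 1 ≤ d) {L : ℕ} (hL : 1 ≤ L) {B₀ B₀' B₁ cB9 cL cP₁ cP₂ cu cw : ℝ} (hB₀ : 0 < B₀) (hB₀' : 0 < B₀')
    (hB₁ : 0 ≤ B₁) (hcB9 : 0 < cB9) (hcL : 0 < cL) (hcP₁ : 0 < cP₁) (hcP₂ : 0 < cP₂) (hcu : 0 < cu) (hcw : 0 < cw) :
    ∃ c₀ : ℝ, 0 < c₀ ∧ ∀ α₀ α₁ : ℝ, 0 < α₀ → 0 < α₁ → α₀ + α₁ ≤ c₀ →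
      α₀ + α₁ ≤ cw ∧ α₀ ≤ cL ∧
      8 * B₀' * (5 * (d : ℝ) * L * B₀) * (α₀ + alpha1e d α₀ α₁) < cu ∧
      α₀ ≤ cB9 ∧ guardT d L B₀ (8 * B₀' * (5 * (d : ℝ) * L * B₀)) α₀ α₁ ≤ cB9 ∧
      α₀ + alpha1e d α₀ α₁ ≤ cP₁ ∧ α₀ + alpha1e d α₀ α₁ ≤ cP₂ ∧
      B₁ * (α₀ + α₁) / (5 * (d : ℝ) * L * B₀) ≤ cP₂ := by
  have hdpos : 0 < d := by omega
  have hLpos : 0 < L := by omega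
  -- the scales
  obtain ⟨D, hD⟩ : ∃ D : ℝ, D = 1 + 11 * (d : ℝ) ^ 2 := ⟨_, rfl⟩
  have hD0 : 0 < D := by rw [hD]; positivity
  obtain ⟨K₁, hK₁⟩ : ∃ K₁ : ℝ, K₁ = 5 * (d : ℝ) * L * B₀ := ⟨_, rfl⟩
  have hK₁0 : 0 < K₁ := by rw [hK₁]; positivity
  obtain ⟨K₄, hK₄⟩ : ∃ K₄ : ℝ, K₄ = 8 * B₀' * K₁ := ⟨_, rfl⟩
  have hK₄0 : 0 < K₄ := by rw [hK₄]; positivity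
  obtain ⟨Kg, hKg⟩ : ∃ Kg : ℝ, Kg = 2 * (L * K₁) + 8 * K₄ := ⟨_, rfl⟩
  have hKg0 : 0 < Kg := by rw [hKg]; positivity
  have hB₁1 : 0 < B₁ + 1 := by linarith
  refine ⟨min cw (min cL (min cB9 (min (cu / (2 * (K₄ * D))) (min (cB9 / (Kg * D)) (min (cP₁ / D) (min (cP₂ / D)
      (cP₂ * K₁ / (B₁ + 1)))))))),
    lt_min hcw (lt_min hcL (lt_min hcB9 (lt_min (by positivity) (lt_min (by positivity) (lt_min (by positivity)
      (lt_min (by positivity) (by positivity))))))), fun α₀ α₁ hα₀ hα₁ hc => ?_⟩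
  have h_cw : α₀ + α₁ ≤ cw := hc.trans (min_le_left _ _)
  have h_cL : α₀ + α₁ ≤ cL := hc.trans ((min_le_right _ _).trans (min_le_left _ _))
  have h_c9 : α₀ + α₁ ≤ cB9 := hc.trans ((min_le_right _ _).trans ((min_le_right _ _).trans (min_le_left _ _)))
  have h_cu : α₀ + α₁ ≤ cu / (2 * (K₄ * D)) :=
    hc.trans ((min_le_right _ _).trans ((min_le_right _ _).trans ((min_le_right _ _).trans (min_le_left _ _))))
  have h_g : α₀ + α₁ ≤ cB9 / (Kg * D) :=
    hc.trans ((min_le_right _ _).trans ((min_le_right _ _).trans ((min_le_right _ _).trans ((min_le_right _ _).trans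
      (min_le_left _ _)))))
  have h_P1 : α₀ + α₁ ≤ cP₁ / D :=
    hc.trans ((min_le_right _ _).trans ((min_le_right _ _).trans ((min_le_right _ _).trans ((min_le_right _ _).trans
      ((min_le_right _ _).trans (min_le_left _ _))))))
  have h_P2 : α₀ + α₁ ≤ cP₂ / D :=
    hc.trans ((min_le_right _ _).trans ((min_le_right _ _).trans ((min_le_right _ _).trans ((min_le_right _ _).trans
      ((min_le_right _ _).trans ((min_le_right _ _).trans (min_le_left _ _)))))))
  have h_B : α₀ + α₁ ≤ cP₂ * K₁ / (B₁ + 1) :=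
    hc.trans ((min_le_right _ _).trans ((min_le_right _ _).trans ((min_le_right _ _).trans ((min_le_right _ _).trans
      ((min_le_right _ _).trans ((min_le_right _ _).trans (min_le_right _ _)))))))
  -- the renamed `α₁ᵉ = 11d²α₀ + α₁` of (1.66): `α₀ + α₁ᵉ ≤ (1 + 11d²)(α₀ + α₁)`
  have hE : α₀ + alpha1e d α₀ α₁ ≤ D * (α₀ + α₁) := by
    have : 0 ≤ (d : ℝ) ^ 2 * α₁ := by positivity
    rw [hD]; unfold alpha1e; linarith
  have hDP1 : D * (cP₁ / D) = cP₁ := by field_simp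
  have hDP2 : D * (cP₂ / D) = cP₂ := by field_simp
  refine ⟨h_cw, by linarith, ?_, by linarith, ?_, ?_, ?_, ?_⟩
  · -- `α₄ < c_u`
    have h1 : 8 * B₀' * (5 * (d : ℝ) * L * B₀) * (α₀ + alpha1e d α₀ α₁) = K₄ * (α₀ + alpha1e d α₀ α₁) := by rw [hK₄, hK₁]
    have h4 : K₄ * (D * (cu / (2 * (K₄ * D)))) = cu / 2 := by field_simp
    rw [h1]
    calc K₄ * (α₀ + alpha1e d α₀ α₁) ≤ K₄ * (D * (α₀ + α₁)) := mul_le_mul_of_nonneg_left hE hK₄0.le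
      _ ≤ K₄ * (D * (cu / (2 * (K₄ * D)))) := mul_le_mul_of_nonneg_left (mul_le_mul_of_nonneg_left h_cu hD0.le) hK₄0.le
      _ = cu / 2 := h4
      _ < cu := by linarith
  · -- the guard `2Lc⋆ + 8α₄ ≤ c_B9`
    have h1 : guardT d L B₀ (8 * B₀' * (5 * (d : ℝ) * L * B₀)) α₀ α₁ = Kg * (α₀ + alpha1e d α₀ α₁) := by
      unfold guardT cstarT alpha4T; rw [hKg, hK₄, hK₁]; ring
    have h4 : Kg * (D * (cB9 / (Kg * D))) = cB9 := by field_simp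
    rw [h1]
    calc Kg * (α₀ + alpha1e d α₀ α₁) ≤ Kg * (D * (α₀ + α₁)) := mul_le_mul_of_nonneg_left hE hKg0.le
      _ ≤ Kg * (D * (cB9 / (Kg * D))) := mul_le_mul_of_nonneg_left (mul_le_mul_of_nonneg_left h_g hD0.le) hKg0.le
      _ = cB9 := h4
  · calc α₀ + alpha1e d α₀ α₁ ≤ D * (α₀ + α₁) := hE
      _ ≤ D * (cP₁ / D) := mul_le_mul_of_nonneg_left h_P1 hD0.le
      _ = cP₁ := hDP1
  · calc α₀ + alpha1e d α₀ α₁ ≤ D * (α₀ + α₁) := hE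
      _ ≤ D * (cP₂ / D) := mul_le_mul_of_nonneg_left h_P2 hD0.le
      _ = cP₂ := hDP2
  · -- `α₀ + α₁′ = B₁(α₀ + α₁)/(5dLB₀) ≤ cP₂`
    rw [← hK₁, div_le_iff₀ hK₁0]
    have h2 : (B₁ + 1) * (α₀ + α₁) ≤ (B₁ + 1) * (cP₂ * K₁ / (B₁ + 1)) := mul_le_mul_of_nonneg_left h_B hB₁1.le
    have h3 : (B₁ + 1) * (cP₂ * K₁ / (B₁ + 1)) = cP₂ * K₁ := by field_simp
    rw [h3] at h2
    nlinarith [h2, hα₀, hα₁]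

end Threshold

/-! ## §2 The six sockets at one pair, explicit windows -/

section Pair

variable {𝔸 : Type*} [CStarAlgebra 𝔸] [Nontrivial 𝔸]
variable (τ : 𝔸 →L[ℂ] ℂ)

/-- ★ **ALL SIX SOCKETS OF THEOREM 2 ON THE TORUS AT ONE `G`-VALUED `P`-PERIODIC PAIR, FROM THE LETTERS AT `U₀`** (explicit windows):
`B8Thm2TorusSupplier.Thm2TorusSockets L k P η 0 B₀ (2B₀) (8B₀′·5dLB₀) c_u B₁ len G α₀ α₁ U₀ U′` for `G ≤ U(𝔸)` averaging-closed inside `H` with the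
`τ`-laws (J-SU data), a pair `U₀, U′` in Theorem 2's regime (1.33)–(1.35) at `k ≥ 1` levels on `T_η` (`P ∈ Lᵏℤ`), GIVEN the [4] letters at `U₀` at
every truncation `1 ≤ n ≤ k` (`ℓu`, with `ℓ`, `ℓτ` at the top), the b9 socket at every truncation, and the windows: Theorem 2's
`Thm2TorusWindows`, the JOIN family below `cP₁` and the uniqueness family (instance `2B₀`, radius `α₄ᵘ`, domain `c_u`) below `cP₂`, evaluated at
`(α₀, α₁ᵉ)` (`α₁ᵉ = 11d²α₀ + α₁`, Theorem 4 run at the renamed `α₁` of (1.66), p. 88) and at `(α₀, α₁′)` with `5dLB₀(α₀ + α₁′) = B₁(α₀ + α₁)`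
(Theorem 2's constant of (1.36)₁ in the uniqueness socket).  Conjuncts: Prop. 5 base (p. 89; the (1.36) exponent of `U′` from (1.65) `|U′ − 1| ≤ α₁ᵉ
≤ ⅙`) and step (p. 94) with «exactly one» discharged (`B8Thm2TorusServerP3`), (1.42) at the levels `m < k` (constant `α₁ᵉ`) and at the top
(constant `α₁`), (1.59) with `β₀ = 0`, `B₀(β₀) = 2B₀` (`B8Thm2TorusSock142159`), and (1.109) at `c_A = B₁(α₀ + α₁)`.
[cite: Balaban1985RegularSpaces, Thm 2 p.83, (1.33)–(1.36) p.82, Thm 4 p.88, (1.65)–(1.66) p.87, Prop. 5 (1.106)–(1.109) p.94, p.95, (1.42) p.83, (1.59) p.86; Balaban1985BackgroundPropagators, Thms 3.1–3.3 pp.397–399] -/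
theorem thm2TorusSockets_of_lettersAt (hτ : ∀ x y : 𝔸, τ (x * y) = τ (y * x)) (hd2 : 2 ≤ d) {L : ℕ} (hL : 2 ≤ L) {η : ℝ} (hη : 0 < η)
    {k : ℕ} (hk : 1 ≤ k) {P : ℤ} (hP : ∃ M : ℤ, P = (L : ℤ) ^ k * M)
    {G H : Subgroup 𝔸ˣ} (hGrp2 : ∀ g ∈ H, ‖(g : 𝔸) - 1‖ ≤ 1 / 8 → τ (mlog (g : 𝔸)) = 0) (hGrp3 : ∀ S : 𝔸, τ S = 0 → expUnit S ∈ H)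
    (hGA : AvgClosed d L G) (hGH : G ≤ H) (hGu : G ≤ unitaryUnits 𝔸)
    (hG3 : ∀ (lam : Site d → 𝔸) (x : Site d), IsSelfAdjoint (lam x) → τ (lam x) = 0 → gaugeExp lam x ∈ G)
    {α₀ α₁ α₁' B₀ B₀' B₀'H B₂' BG BR B₀β cB9 cB β cu α₄u B₁ cP₁ cP₂ : ℝ} {len : Site d → ℝ}
    (hα₀ : 0 < α₀) (hα₁ : 0 < α₁) (hB₀ : 0 < B₀) (hB₀' : 0 < B₀') (hB₀'H : 0 < B₀'H) (hB₂' : 0 ≤ B₂') (hBG : 0 ≤ BG) (hBR : 0 ≤ BR)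
    (hα₄u : 0 < α₄u)
    (hW : Thm2TorusWindows d L B₀ (8 * B₀' * (5 * (d : ℝ) * L * B₀)) cu B₁ α₀ α₁)
    (hcu : 8 * B₀' * (5 * (d : ℝ) * L * B₀) * (α₀ + alpha1e d α₀ α₁) < cu)
    (hα₀9 : α₀ ≤ cB9) (hg9 : guardT d L B₀ (8 * B₀' * (5 * (d : ℝ) * L * B₀)) α₀ α₁ ≤ cB9)
    (hα₁'eq : 5 * (d : ℝ) * L * B₀ * (α₀ + α₁') = B₁ * (α₀ + α₁)) (hα₁'e : alpha1e d α₀ α₁ ≤ α₁')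
    (h₁ : α₀ + alpha1e d α₀ α₁ ≤ cP₁) (h₂ : α₀ + alpha1e d α₀ α₁ ≤ cP₂) (h₃ : α₀ + α₁' ≤ cP₂)
    (hfpF : ∀ α₀ α₁ : ℝ, 0 < α₀ → 0 < α₁ → α₀ + α₁ ≤ cP₁ →
      ∀ cs α₄ cB cDA hE hE₂ lE lE₂ : ℝ, cs = 5 * (d : ℝ) * L * B₀ * (α₀ + α₁) → α₄ = 8 * B₀' * (5 * (d : ℝ) * L * B₀) * (α₀ + α₁) →
      cB = L * cs → cDA = 2 * (d : ℝ) * (L : ℝ) ^ 2 * cs →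
      hE = B₀'H * (C2p d * (40 * d * cB + α₄) * α₄) → hE₂ = B₂' * (C2p d * (40 * d * cB + α₄) * α₄) →
      lE = B₀'H * (4 * C2p d * (40 * d * cB + 2 * α₄)) → lE₂ = B₂' * (4 * C2p d * (40 * d * cB + 2 * α₄)) →
      36 * d * B₀ * cs ≤ 1 / 2 ∧
      8 * (131072 * ((d : ℝ) + 1) ^ 2) * Real.exp (4 * (800 * ((d : ℝ) + 1) ^ 2 * ((d : ℝ) + 4)) * α₀) ≤ 16 * (131072 * ((d : ℝ) + 1) ^ 2) ∧
      2 * cs ^ 2 + 20 * d * α₀ * cs + 2 * (16 * (131072 * ((d : ℝ) + 1) ^ 2)) * cs ^ 2 ≤ α₀ + α₁ ∧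
      (d : ℝ) * L * α₁ ≤ 1 / 8 ∧
      α₀ ≤ cB9 ∧ cs ≤ cB9 ∧
      C0 d * α₀ ≤ 1 / 3 ∧ 4 * α₀ ≤ c2' d L ∧
      Real.exp (4 * (800 * ((d : ℝ) + 1) ^ 2 * ((d : ℝ) + 4)) * α₀) * (1 + 8 * (131072 * ((d : ℝ) + 1) ^ 2) * cB) ≤ 2 ∧
      2 * cB ≤ c3 d L ∧ 2048 * (d : ℝ) * cB ≤ 1 ∧ 40 * d * cB ≤ 1 / 200 ∧
      200 * C6 d * (2 * α₄) ≤ 1 ∧ 12000 * ((d : ℝ) + 1) * L * (2 * α₄) ≤ 1 ∧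
      C4G d L * (α₀ + 40 * d * cB + 4 * (2 * α₄)) ≤ 1 ∧
      1024 * ((d : ℝ) + 1) * ((d : ℝ) + 4) * L ^ 2 * α₀ ≤ 1 ∧ 32 * ((d : ℝ) + 1) ^ 2 * C6 d * L ^ 2 * α₀ ≤ 1 ∧
      16 * d * C5' d * C6 d * (L : ℝ) ^ 2 * α₀ ≤ 1 ∧ 8 * d * C6 d * L * α₀ ≤ 1 ∧
      40 * d * cB + α₄ ≤ 1 / (4 * B₀'H * (2 * C2p d)) ∧ 2 * C6 d * (40 * d * cB + 4 * α₄) ≤ 1 / 8 ∧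
      cB ≤ 1 / 13 ∧ α₄ / 4 + hE ≤ 1 / 24 ∧ α₄ / 4 + hE ≤ 1 / 140 ∧ 10 * (α₄ / 4 + hE) * BR ≤ 1 / 2 ∧
      BG * Mc d BR (α₄ / 4 + hE) cB hE₂ cDA ≤ α₄ / 4 ∧
      BG * Kc d BR (α₄ / 4 + hE) cB hE₂ cDA lE₂ (1 + lE) (1 + lE) ≤ 1 / 2)
    (huF : ∀ α₀ α₁ : ℝ, 0 < α₀ → 0 < α₁ → α₀ + α₁ ≤ cP₂ →
      ∀ cs cB cDA hE hE₂ lE lE₂ : ℝ, cs = 5 * (d : ℝ) * L * (2 * B₀) * (α₀ + α₁) → cB = L * cs → cDA = (d : ℝ) * (L : ℝ) ^ 2 * cs →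
      hE = B₀'H * (C2p d * (40 * d * cB + α₄u) * α₄u) → hE₂ = B₂' * (C2p d * (40 * d * cB + α₄u) * α₄u) →
      lE = B₀'H * (4 * C2p d * (40 * d * cB + 2 * α₄u)) → lE₂ = B₂' * (4 * C2p d * (40 * d * cB + 2 * α₄u)) →
      36 * d * (2 * B₀) * cs ≤ 1 / 2 ∧
      8 * (131072 * ((d : ℝ) + 1) ^ 2) * Real.exp (4 * (800 * ((d : ℝ) + 1) ^ 2 * ((d : ℝ) + 4)) * α₀) ≤ 16 * (131072 * ((d : ℝ) + 1) ^ 2) ∧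
      2 * cs ^ 2 + 20 * d * α₀ * cs + 2 * (16 * (131072 * ((d : ℝ) + 1) ^ 2)) * cs ^ 2 ≤ α₀ + α₁ ∧
      (d : ℝ) * L * α₁ ≤ 1 / 8 ∧
      α₀ ≤ cB9 ∧ cs ≤ cB9 ∧
      C0 d * α₀ ≤ 1 / 3 ∧ 4 * α₀ ≤ c2' d L ∧
      Real.exp (4 * (800 * ((d : ℝ) + 1) ^ 2 * ((d : ℝ) + 4)) * α₀) * (1 + 8 * (131072 * ((d : ℝ) + 1) ^ 2) * cB) ≤ 2 ∧
      2 * cB ≤ c3 d L ∧ 2048 * (d : ℝ) * cB ≤ 1 ∧ 40 * d * cB ≤ 1 / 200 ∧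
      200 * C6 d * (2 * α₄u) ≤ 1 ∧ 12000 * ((d : ℝ) + 1) * L * (2 * α₄u) ≤ 1 ∧
      C4G d L * (α₀ + 40 * d * cB + 4 * (2 * α₄u)) ≤ 1 ∧
      1024 * ((d : ℝ) + 1) * ((d : ℝ) + 4) * L ^ 2 * α₀ ≤ 1 ∧ 32 * ((d : ℝ) + 1) ^ 2 * C6 d * L ^ 2 * α₀ ≤ 1 ∧
      16 * d * C5' d * C6 d * (L : ℝ) ^ 2 * α₀ ≤ 1 ∧ 8 * d * C6 d * L * α₀ ≤ 1 ∧
      40 * d * cB + α₄u ≤ 1 / (4 * B₀'H * (2 * C2p d)) ∧ 2 * C6 d * (40 * d * cB + 4 * α₄u) ≤ 1 / 8 ∧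
      cB ≤ 1 / 13 ∧ α₄u / 4 + hE ≤ 1 / 24 ∧ α₄u / 4 + hE ≤ 1 / 140 ∧ 10 * (α₄u / 4 + hE) * BR ≤ 1 / 2 ∧
      BG * Mc d BR (α₄u / 4 + hE) cB hE₂ cDA ≤ α₄u / 4 ∧
      BG * Kc d BR (α₄u / 4 + hE) cB hE₂ cDA lE₂ (1 + lE) (1 + lE) ≤ 1 / 2 ∧
      lE ≤ 1 / 2 ∧ cu + hE ≤ α₄u / 4)
    {U₀ U' : Site d → Fin d → 𝔸ˣ} (hU₀G : ∀ x κ, U₀ x κ ∈ G) (hU'G : ∀ x κ, U' x κ ∈ G)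
    (hU₀P : ∀ i : Fin d, shiftCfg (P • e i) U₀ = U₀) (hU'P : ∀ i : Fin d, shiftCfg (P • e i) U' = U')
    (h33 : InAk L k η α₀ (fun _ => (Set.univ : Set (Site d))) U₀)
    (h34 : InAk L k η α₀ (fun _ => (Set.univ : Set (Site d))) (U' * U₀))
    (hAx : InAx L k (torusLam k) U₀ (U' * U₀)) (h35 : Hyp135 L k (torusLam k) α₁ U₀ U')
    (ℓ : LettersAt (𝔸 := 𝔸) L BG BR B₀'H B₂' B₀ B₀β cB β len η k α₀ U₀) (ℓτ : LettersTau (𝔸 := 𝔸) τ ℓ)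
    (ℓu : ∀ n, 1 ≤ n → n ≤ k → LettersAt (𝔸 := 𝔸) L BG BR B₀'H B₂' B₀ B₀β cB β len η n α₀ U₀)
    (SB9all : (∀ m, m ≤ k → SockB9P3 (𝔸 := 𝔸) L B₀ B₀β cB9 β len η m (fun _ => (Set.univ : Set (Site d)))
          (fun m => torusLam (d := d) m) (fun m => torusLamb (d := d) m))) :
    Thm2TorusSockets L k P η 0 B₀ (2 * B₀) (8 * B₀' * (5 * (d : ℝ) * L * B₀)) cu B₁ len G α₀ α₁ U₀ U' := by
  have hL1 : 1 ≤ L := le_trans (by norm_num) hL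
  have hd1 : 1 ≤ d := le_trans (by norm_num) hd2
  have hLpos : 0 < L := by omega
  have hdpos : 0 < d := by omega
  have hU₀ : ∀ x κ, U₀ x κ ∈ unitaryUnits 𝔸 := fun x κ => hGu (hU₀G x κ)
  have hU' : ∀ x κ, U' x κ ∈ unitaryUnits 𝔸 := fun x κ => hGu (hU'G x κ)
  have hU₀p : ∀ (x : Site d) (i : Fin d), U₀ (x + P • e i) = U₀ x := fun x i => funext fun κ => apply_add_of_shiftCfg hU₀P x i κ
  have hU'p : ∀ (x : Site d) (i : Fin d), U' (x + P • e i) = U' x := fun x i => funext fun κ => apply_add_of_shiftCfg hU'P x i κ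
  have hα₁e0 : 0 < alpha1e d α₀ α₁ := by unfold alpha1e; positivity
  have hα₁le : α₁ ≤ alpha1e d α₀ α₁ := by
    have : 0 ≤ 11 * (d : ℝ) ^ 2 * α₀ := by positivity
    unfold alpha1e; linarith
  have hα₁'0 : 0 < α₁' := lt_of_lt_of_le hα₁e0 hα₁'e
  have hα2 : 2 * α₀ ≤ c2' d L := by linarith [hW.c2]
  have hg0 : 0 < guardT d L B₀ (8 * B₀' * (5 * (d : ℝ) * L * B₀)) α₀ α₁ := by unfold guardT cstarT alpha4T; positivity
  -- Theorem 4's data at every level `≤ k` and the all-levels closeness (1.66) `≤ α₁ᵉ`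
  have hAx' : ∀ m', m' ≤ k → InAx L m' (torusLam (d := d) m') U₀ (mulCfg U' U₀) := inAx_torusLam_all hL1 hAx
  have h135all : ∀ j, j ≤ k → ∀ (z : Site d) (μ : Fin d),
      ‖(avgIter L (mulCfg U' U₀) j z μ : 𝔸) - (avgIter L U₀ j z μ : 𝔸)‖ ≤ alpha1e d α₀ α₁ :=
    h135_allLevels hd1 hL k hU₀ hU' hα₀ hW.c0 hα2 hα₁ hW.a6 h33 h34 hAx h35
  -- the window families at `(α₀, α₁ᵉ)` and `(α₀, α₁′)`
  have hwin := hfpF α₀ (alpha1e d α₀ α₁) hα₀ hα₁e0 h₁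
  have huw := huF α₀ (alpha1e d α₀ α₁) hα₀ hα₁e0 h₂
  have huw' := huF α₀ α₁' hα₀ hα₁'0 h₃
  obtain ⟨-, -, -, hsmall₁, -⟩ := hwin _ _ _ _ _ _ _ _ rfl rfl rfl rfl rfl rfl rfl rfl
  have hsmall₁' : (d : ℝ) * L * α₁ ≤ 1 / 8 := (mul_le_mul_of_nonneg_left hα₁le (by positivity)).trans hsmall₁
  -- the (1.36) exponent `A₀ = (iη)⁻¹ log U′` of `U′` at the base: `|U′ − 1| ≤ α₁ᵉ ≤ ⅙` by (1.65), `|A₀| ≤ 2α₁ᵉη⁻¹ ≤ c⋆η⁻¹`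
  have hdat : ∀ (x : Site d) (κ : Fin d),
      U' x κ = cfgExp η (fun y μ => η⁻¹ • ((I⁻¹ : ℂ) • mlog ((U' y μ : 𝔸ˣ) : 𝔸))) x κ ∧
        IsSelfAdjoint (η⁻¹ • ((I⁻¹ : ℂ) • mlog ((U' x κ : 𝔸ˣ) : 𝔸))) ∧
        ‖η⁻¹ • ((I⁻¹ : ℂ) • mlog ((U' x κ : 𝔸ˣ) : 𝔸))‖ ≤
          (5 * (d : ℝ) * L * B₀ * (α₀ + alpha1e d α₀ α₁)) * ((L : ℝ) ^ 0 * η)⁻¹ := by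
    intro x κ
    have hb : ‖((U' x κ : 𝔸ˣ) : 𝔸) - 1‖ ≤ alpha1e d α₀ α₁ :=
      norm_sub_one_le_torus hd1 hL k hU₀ hU' hα₀ hW.c0 hα2 hα₁.le hW.a6 h33 h34 hAx h35 x κ
    obtain ⟨-, h1, h2, h3⟩ := base_datum hη U₀ U' hU' (a := alpha1e d α₀ α₁) (by linarith [hW.a6]) x κ hb
    refine ⟨h1, h2, h3.trans ?_⟩
    have ha2 : 2 * alpha1e d α₀ α₁ ≤ 5 * (d : ℝ) * L * B₀ * (α₀ + alpha1e d α₀ α₁) := by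
      have h := hW.a2; unfold cstarT at h; exact h
    rw [pow_zero, one_mul]
    exact mul_le_mul_of_nonneg_right ha2 (inv_nonneg.2 hη.le)
  -- the six sockets
  have hS1 := sockP5Base_of_lettersAt_u τ hτ hd2 hL hη hk hP hGrp2 hGrp3 hGA hGH hGu hG3 hα₀ hα₁e0 hB₀ hB₀' hB₀'H hB₂' hBG hBR
    hα₄u hcu hU₀G hU'G hU₀p hU'p h33 h34 hAx' ℓ ℓτ (ℓu 1 le_rfl hk) hwin huw hdat
  have hS2 := sockP5Step_of_lettersAt_u τ hτ hd2 hL hη hP hGrp2 hGrp3 hGA hGH hGu hG3 hα₀ hα₁e0 hB₀ hB₀' hB₀'H hB₂' hBG hBR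
    hα₄u hcu hU₀G hU'G hU₀p hU'p h33 h34 hAx' (fun j hj z μ _ => h135all j hj z μ) ℓ ℓτ ℓu SB9all hwin huw
  have hS3 := sock142_of135 (P := P) hd2 hη hL k hGu hU₀G hU'G hα₀ hα₁ hg0.le hW.c0 hW.c2 hW.g16 hW.gexp hW.gc3 hW.a6 hsmall₁
    h33 h34 hAx h35
  have hS4 := sock142_top (P := P) hd2 hη hL hk hGu hU₀G hα₀ hα₁ hg0.le hW.c0 hW.c2 hW.g16 hW.gexp hW.gc3 hsmall₁' h33 hAx h35
  have hS6 := sockP5Uniq_of_lettersAt (P := P) hd2 hL hη hk hGu hα₀ hα₁'0 hB₀ hα₄u hU₀G hU'G h33 h34 hAx'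
    (fun j hj z μ _ => (h135all j hj z μ).trans hα₁'e) (SB9all k le_rfl) hB₀'H hB₂' hBG hBR ℓ huw'
  rw [hα₁'eq] at hS6
  unfold Thm2TorusSockets
  exact ⟨hS1, hS2, fun m hm1 hmk => hS3 m hm1 hmk.le, hS4,
    fun m _ hmk => sock159_of_sockB9P3 hd2 hη hL hGu hU₀G hU'G hα₀ hg0 hα₀9 hg9 hB₀.le h33 h34 hmk (SB9all m hmk), hS6⟩

end Pair

/-! ## §3 The member-uniform servers: the six sockets, and `Thm2TorusAt … G (fun _ => True)` -/

section Uniform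

variable {𝔸 : Type*} [CStarAlgebra 𝔸] [Nontrivial 𝔸]
variable (τ : 𝔸 →L[ℂ] ℂ)

/-- ★ **THE SIX SOCKETS OF THEOREM 2 ON THE TORUS, MEMBER-UNIFORMLY, FROM THE LETTERS** (the consumer's shape (a)): for `d, L ≥ 2`, `G ≤ U(𝔸)`
averaging-closed inside `H` with the `τ`-laws, the letters' constants with `5dLB₀ ≥ 2`, `3·(2dL²)·B_G·B_R ≤ B₀′` and `B₁ ≥ 5dLB₀(1 + 11d²)` there are
`c_u, c₀ > 0` — depending on these data only, NOT on `k`, `P`, `η` — such that (i) Theorem 2's windows `Thm2TorusWindows d L B₀ (8B₀′·5dLB₀) c_u B₁`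
hold below `c₀`, and (ii) at every torus member (`k ≥ 1`, `P ∈ Lᵏℤ`, `η > 0`) carrying the letters `LettersAllP … cL η k P G` with their `τ`-laws and
the b9 socket at every truncation, for all `α₀, α₁ > 0` with `α₀ + α₁ ≤ c₀` and every `G`-valued `P`-periodic pair in the regime (1.33)–(1.35):
`Thm2TorusSockets L k P η 0 B₀ (2B₀) (8B₀′·5dLB₀) c_u B₁ len G α₀ α₁ U₀ U′`.  Feed (i)–(ii) to `B8Thm2TorusSupplier.thm2TorusAt_of_sockets`.
[cite: Balaban1985RegularSpaces, Thm 2 p.83, p.83 («B₁, B₂(β₀) … absolute constants depending on d and L only»), p.95, Prop. 5 p.94, (1.42) p.83, (1.59) p.86; Balaban1985BackgroundPropagators, Thms 3.1–3.3 pp.397–399] -/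
theorem thm2TorusSockets_uniform_of_letters (hτ : ∀ x y : 𝔸, τ (x * y) = τ (y * x)) (hd2 : 2 ≤ d) {L : ℕ} (hL : 2 ≤ L)
    {G H : Subgroup 𝔸ˣ} (hGrp2 : ∀ g ∈ H, ‖(g : 𝔸) - 1‖ ≤ 1 / 8 → τ (mlog (g : 𝔸)) = 0) (hGrp3 : ∀ S : 𝔸, τ S = 0 → expUnit S ∈ H)
    (hGA : AvgClosed d L G) (hGH : G ≤ H) (hGu : G ≤ unitaryUnits 𝔸)
    (hG3 : ∀ (lam : Site d → 𝔸) (x : Site d), IsSelfAdjoint (lam x) → τ (lam x) = 0 → gaugeExp lam x ∈ G)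
    {B₀ B₀' B₀'H B₂' BG BR B₀β cB9 cB β cL B₁ : ℝ} {len : Site d → ℝ}
    (hB₀ : 0 < B₀) (hB₀' : 0 < B₀') (hB : 2 ≤ 5 * (d : ℝ) * L * B₀) (hB₀'H : 0 < B₀'H) (hB₂' : 0 ≤ B₂') (hBG : 0 ≤ BG) (hBR : 0 ≤ BR)
    (hcB9 : 0 < cB9) (hcL : 0 < cL) (hfree : 3 * (2 * (d : ℝ) * (L : ℝ) ^ 2) * BG * BR ≤ B₀')
    (hB₁ : 5 * (d : ℝ) * L * B₀ * (1 + 11 * (d : ℝ) ^ 2) ≤ B₁) :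
    ∃ cu c₀ : ℝ, 0 < cu ∧ 0 < c₀ ∧
      (∀ ⦃α₀ α₁ : ℝ⦄, 0 < α₀ → 0 < α₁ → α₀ + α₁ ≤ c₀ → Thm2TorusWindows d L B₀ (8 * B₀' * (5 * (d : ℝ) * L * B₀)) cu B₁ α₀ α₁) ∧
      ∀ (k : ℕ) (P : ℤ) (η : ℝ), 1 ≤ k → 0 < η → (∃ M : ℤ, P = (L : ℤ) ^ k * M) →
      ∀ ℓP : LettersAllP (𝔸 := 𝔸) L BG BR B₀'H B₂' B₀ B₀β cB β len cL η k P G, LettersAllPTau (𝔸 := 𝔸) τ ℓP →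
      (∀ m, m ≤ k → SockB9P3 (𝔸 := 𝔸) L B₀ B₀β cB9 β len η m (fun _ => (Set.univ : Set (Site d)))
          (fun m => torusLam (d := d) m) (fun m => torusLamb (d := d) m)) →
      ∀ ⦃α₀ α₁ : ℝ⦄, 0 < α₀ → 0 < α₁ → α₀ + α₁ ≤ c₀ → ∀ U₀ U' : Site d → Fin d → 𝔸ˣ,
        (∀ x κ, U₀ x κ ∈ G) → (∀ x κ, U' x κ ∈ G) →
        (∀ i : Fin d, shiftCfg (P • e i) U₀ = U₀) → (∀ i : Fin d, shiftCfg (P • e i) U' = U') →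
        InAk L k η α₀ (fun _ => (Set.univ : Set (Site d))) U₀ → InAk L k η α₀ (fun _ => (Set.univ : Set (Site d))) (U' * U₀) →
        InAx L k (torusLam k) U₀ (U' * U₀) → Hyp135 L k (torusLam k) α₁ U₀ U' →
        Thm2TorusSockets L k P η 0 B₀ (2 * B₀) (8 * B₀' * (5 * (d : ℝ) * L * B₀)) cu B₁ len G α₀ α₁ U₀ U' := by
  have hL1 : 1 ≤ L := le_trans (by norm_num) hL
  have hd1 : 1 ≤ d := le_trans (by norm_num) hd2
  have hLpos : 0 < L := by omega
  have hdpos : 0 < d := by omega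
  have h5 : 0 < 5 * (d : ℝ) * L * B₀ := by positivity
  have hB₁0 : 0 ≤ B₁ := le_trans (by positivity) hB₁
  -- the window families and Theorem 2's windows, then the one threshold
  obtain ⟨cP₁, hcP₁, hfpF⟩ := hfpWindows_of_guard hd1 hL1 hB₀ hB₀' hB hB₀'H hB₂' hBG hBR hcB9 hfree
  have hB2 : 2 ≤ 5 * (d : ℝ) * L * (2 * B₀) := by linarith
  obtain ⟨α₄u, cu, cP₂, hα₄u, hcu, hcP₂, huF⟩ :=
    uniqWindows_of_guard hd1 hL1 (B₀ := 2 * B₀) (by positivity) hB2 hB₀'H hB₂' hBG hBR hcB9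
  obtain ⟨cw, hcw, hWF⟩ :=
    thm2TorusWindows_threshold hd1 hL1 hB (B₄ := 8 * B₀' * (5 * (d : ℝ) * L * B₀)) (by positivity) hcu hB₁0
  obtain ⟨c₀, hc₀, hT⟩ := serverWindows_threshold hd1 hL1 hB₀ hB₀' hB₁0 hcB9 hcL hcP₁ hcP₂ hcu hcw
  refine ⟨cu, c₀, hcu, hc₀, fun α₀ α₁ hα₀ hα₁ hc => hWF hα₀ hα₁ (hT α₀ α₁ hα₀ hα₁ hc).1, ?_⟩
  intro k P η hk hη hP ℓP ℓPτ SB9all α₀ α₁ hα₀ hα₁ hc U₀ U' hU₀G hU'G hU₀P hU'P h33 h34 hAx h35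
  obtain ⟨hcw', hcL', hcu', hα₀9, hg9, h₁, h₂, h₃⟩ := hT α₀ α₁ hα₀ hα₁ hc
  have hU₀p : ∀ (x : Site d) (i : Fin d), U₀ (x + P • e i) = U₀ x := fun x i => funext fun κ => apply_add_of_shiftCfg hU₀P x i κ
  -- the letters at `U₀`, every truncation `n ≤ k` (`𝔄_k ⊂ 𝔄_n`), and the `τ`-laws at the top
  have ℓu : ∀ n, 1 ≤ n → n ≤ k → LettersAt (𝔸 := 𝔸) L BG BR B₀'H B₂' B₀ B₀β cB β len η n α₀ U₀ :=
    fun n _ hn => ℓP n hn hα₀ hcL' U₀ hU₀G hU₀p (fun j hj => h33 j (hj.trans hn))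
  have ℓτ : LettersTau (𝔸 := 𝔸) τ (ℓP k le_rfl hα₀ hcL' U₀ hU₀G hU₀p h33) := ℓPτ k le_rfl α₀ hα₀ hcL' U₀ hU₀G hU₀p h33
  -- Theorem 2's constant in the uniqueness socket: `5dLB₀(α₀ + α₁′) = B₁(α₀ + α₁)`, `α₁ᵉ ≤ α₁′` («B₁ not too small», p. 89)
  obtain ⟨α₁', hα₁'⟩ : ∃ α₁' : ℝ, α₁' = B₁ * (α₀ + α₁) / (5 * (d : ℝ) * L * B₀) - α₀ := ⟨_, rfl⟩
  have hsum' : α₀ + α₁' = B₁ * (α₀ + α₁) / (5 * (d : ℝ) * L * B₀) := by rw [hα₁']; ring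
  have hα₁'eq : 5 * (d : ℝ) * L * B₀ * (α₀ + α₁') = B₁ * (α₀ + α₁) := by
    rw [hsum']; field_simp
  have hα₁'e : alpha1e d α₀ α₁ ≤ α₁' := by
    have hE : α₀ + alpha1e d α₀ α₁ ≤ (1 + 11 * (d : ℝ) ^ 2) * (α₀ + α₁) := by
      have : 0 ≤ (d : ℝ) ^ 2 * α₁ := by positivity
      unfold alpha1e; linarith
    have h1 : 5 * (d : ℝ) * L * B₀ * (α₀ + alpha1e d α₀ α₁) ≤ 5 * (d : ℝ) * L * B₀ * (α₀ + α₁') := by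
      rw [hα₁'eq]
      calc 5 * (d : ℝ) * L * B₀ * (α₀ + alpha1e d α₀ α₁) ≤ 5 * (d : ℝ) * L * B₀ * ((1 + 11 * (d : ℝ) ^ 2) * (α₀ + α₁)) :=
            mul_le_mul_of_nonneg_left hE h5.le
        _ = 5 * (d : ℝ) * L * B₀ * (1 + 11 * (d : ℝ) ^ 2) * (α₀ + α₁) := by ring
        _ ≤ B₁ * (α₀ + α₁) := mul_le_mul_of_nonneg_right hB₁ (by linarith)
    have h2 := le_of_mul_le_mul_left h1 h5
    linarith
  have h₃' : α₀ + α₁' ≤ cP₂ := by rw [hsum']; exact h₃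
  exact thm2TorusSockets_of_lettersAt τ hτ hd2 hL hη hk hP hGrp2 hGrp3 hGA hGH hGu hG3 hα₀ hα₁ hB₀ hB₀' hB₀'H hB₂' hBG hBR hα₄u
    (hWF hα₀ hα₁ hcw') hcu' hα₀9 hg9 hα₁'eq hα₁'e h₁ h₂ h₃' hfpF huF hU₀G hU'G hU₀P hU'P h33 h34 hAx h35
    (ℓP k le_rfl hα₀ hcL' U₀ hU₀G hU₀p h33) ℓτ ℓu SB9all

/-- ★ **THEOREM 2 ON THE TORUS, BOTH HALVES, MEMBER-UNIFORMLY, MODULO THE LETTERS — `B8Thm2TorusAt.Thm2TorusAt L k P η 0 B₁ B₂ c₁ len G (fun _ =>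
True)` SUPPLIED**: under the hypotheses of `thm2TorusSockets_uniform_of_letters` with `B₁ > 5dLB₀(1 + 11d²)` there is ONE pair `B₂, c₁ > 0`
(`B₂ = 5dL(2B₀)(1 + 11d²) + 1`; from `d, L`, the letters' constants and `B₁` only — p. 83 «absolute constants depending on d and L only») such that
at every torus member (`k ≥ 1`, `P ∈ Lᵏℤ`, `η > 0`) carrying the letters, their `τ`-laws and the b9 socket at every truncation: for `α₀, α₁ > 0`
with `α₀ + α₁ ≤ c₁` and `G`-valued `P`-periodic `U₀`, `U′` with (1.33)–(1.35) there is EXACTLY ONE `G`-valued `P`-periodic `u` with (1.29) and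
(1.36)–(1.39) for `U′^{u⁻¹} = e^{iηA}` (`B8Thm2TorusSupplier.thm2TorusAt_of_sockets` fed by `thm2TorusSockets_uniform_of_letters`).  HONEST
SCOPE: Theorem 2 on `T_η` MODULO THE [4] LETTERS (displayed hypotheses; v2 binder), `β₀ = 0`; N05 ∕ `stub_PV3A` NOT discharged; nothing continuum ∕
mass-gap ∕ Clay. [cite: Balaban1985RegularSpaces, Thm 2 p.83, (1.33)–(1.39) pp.82–83, Thm 4 p.88, Prop. 5 p.94, p.95, p.77 («Ω_j = T_η»); Balaban1985BackgroundPropagators, Thms 3.1–3.3 pp.397–399] -/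
theorem thm2TorusAt_uniform_of_letters (hτ : ∀ x y : 𝔸, τ (x * y) = τ (y * x)) (hd2 : 2 ≤ d) {L : ℕ} (hL : 2 ≤ L)
    {G H : Subgroup 𝔸ˣ} (hGrp2 : ∀ g ∈ H, ‖(g : 𝔸) - 1‖ ≤ 1 / 8 → τ (mlog (g : 𝔸)) = 0) (hGrp3 : ∀ S : 𝔸, τ S = 0 → expUnit S ∈ H)
    (hGA : AvgClosed d L G) (hGH : G ≤ H) (hGu : G ≤ unitaryUnits 𝔸)
    (hG3 : ∀ (lam : Site d → 𝔸) (x : Site d), IsSelfAdjoint (lam x) → τ (lam x) = 0 → gaugeExp lam x ∈ G)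
    {B₀ B₀' B₀'H B₂' BG BR B₀β cB9 cB β cL B₁ : ℝ} {len : Site d → ℝ}
    (hB₀ : 0 < B₀) (hB₀' : 0 < B₀') (hB : 2 ≤ 5 * (d : ℝ) * L * B₀) (hB₀'H : 0 < B₀'H) (hB₂' : 0 ≤ B₂') (hBG : 0 ≤ BG) (hBR : 0 ≤ BR)
    (hcB9 : 0 < cB9) (hcL : 0 < cL) (hfree : 3 * (2 * (d : ℝ) * (L : ℝ) ^ 2) * BG * BR ≤ B₀')
    (hB₁ : 5 * (d : ℝ) * L * B₀ * (1 + 11 * (d : ℝ) ^ 2) < B₁) :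
    ∃ B₂ c₁ : ℝ, 0 < B₂ ∧ 0 < c₁ ∧ ∀ (k : ℕ) (P : ℤ) (η : ℝ), 1 ≤ k → 0 < η → (∃ M : ℤ, P = (L : ℤ) ^ k * M) →
      ∀ ℓP : LettersAllP (𝔸 := 𝔸) L BG BR B₀'H B₂' B₀ B₀β cB β len cL η k P G, LettersAllPTau (𝔸 := 𝔸) τ ℓP →
      (∀ m, m ≤ k → SockB9P3 (𝔸 := 𝔸) L B₀ B₀β cB9 β len η m (fun _ => (Set.univ : Set (Site d)))
          (fun m => torusLam (d := d) m) (fun m => torusLamb (d := d) m)) →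
      Thm2TorusAt L k P η 0 B₁ B₂ c₁ len G (fun _ => True) := by
  have hLpos : 0 < L := by omega
  have hdpos : 0 < d := by omega
  obtain ⟨cu, c₀, hcu, hc₀, hW, hS⟩ := thm2TorusSockets_uniform_of_letters τ hτ hd2 hL hGrp2 hGrp3 hGA hGH hGu hG3 hB₀ hB₀' hB hB₀'H
    hB₂' hBG hBR hcB9 hcL hfree hB₁.le
  refine ⟨5 * (d : ℝ) * L * (2 * B₀) * (1 + 11 * (d : ℝ) ^ 2) + 1, c₀, by positivity, hc₀, fun k P η hk hη hP ℓP ℓPτ SB9all => ?_⟩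
  exact thm2TorusAt_of_sockets hd2 hη hL hk P hGu hB₀.le (by positivity) (by positivity) hB₁ (lt_add_one _) hW
    (fun α₀ α₁ hα₀ hα₁ hc U₀ U' hU₀ hU' hU₀P hU'P h33 h34 hAx h35 =>
      hS k P η hk hη hP ℓP ℓPτ SB9all hα₀ hα₁ hc U₀ U' hU₀ hU' hU₀P hU'P h33 h34 hAx h35)

end Uniform

/-! ## §4 `G = SU(N)`, `𝔸 = M_N(ℂ)`, `τ = tr` -/

section SpecialUnitary

open scoped Matrix.Norms.L2Operator
open B7Prop2SpecialUnitary (specialUnitaryUnits specialUnitaryUnits_le_unitaryUnits)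
open B13Inv214OrbitSUN (slUnits)
open B8SpecialUnitaryTrace (trCLM trCLM_mul_comm expUnit_I_smul_mem_specialUnitaryUnits)
open B8SpecialLinearTrace (specialUnitaryUnits_le_slUnits trCLM_mlog_eq_zero_of_mem_slUnits expUnit_mem_slUnits)
open B7AvgClosedSpecialUnitarySharp (avgClosed_specialUnitary_of_le)

variable {N : ℕ} [NeZero N]

/-- ★ **THE SIX SOCKETS OF THEOREM 2 ON THE TORUS FOR `G = SU(N)`, `1 ≤ N ≤ 25`, MEMBER-UNIFORMLY, FROM THE LETTERS** — `thm2TorusSockets_uniform_of_letters`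
at `𝔸 = M_N(ℂ)` (operator norm of [3] (19)), `τ = tr`, `H = SL(N, ℂ)`: the J-SU group data are the tree's (`B8SpecialLinearTrace`: (H2) `tr log h = 0`
on `SL(N)` near `1` for `N ≤ 25`, (H3), `SU(N) ≤ SL(N)`; `B7AvgClosedSpecialUnitarySharp.avgClosed_specialUnitary_of_le`: `SU(N)` averaging-closed for
`N ≤ 25`; (G3) `e^{iλ} ∈ SU(N)` for Hermitian trace-free `λ`).  The shape consumed with `B8Thm2TorusSupplier.thm2TorusAt_specialUnitary_of_sockets`.
[cite: Balaban1985RegularSpaces, Thm 2 p.83, p.76 («G = SU(N)»); Balaban1985Averaging, p.20, (19)–(23) p.21; Balaban1985BackgroundPropagators, Thms 3.1–3.3 pp.397–399] -/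
theorem thm2TorusSockets_specialUnitary_of_letters (hN : N ≤ 25) (hd2 : 2 ≤ d) {L : ℕ} (hL : 2 ≤ L)
    {B₀ B₀' B₀'H B₂' BG BR B₀β cB9 cB β cL B₁ : ℝ} {len : Site d → ℝ}
    (hB₀ : 0 < B₀) (hB₀' : 0 < B₀') (hB : 2 ≤ 5 * (d : ℝ) * L * B₀) (hB₀'H : 0 < B₀'H) (hB₂' : 0 ≤ B₂') (hBG : 0 ≤ BG) (hBR : 0 ≤ BR)
    (hcB9 : 0 < cB9) (hcL : 0 < cL) (hfree : 3 * (2 * (d : ℝ) * (L : ℝ) ^ 2) * BG * BR ≤ B₀')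
    (hB₁ : 5 * (d : ℝ) * L * B₀ * (1 + 11 * (d : ℝ) ^ 2) ≤ B₁) :
    letI : CStarAlgebra (Matrix (Fin N) (Fin N) ℂ) := {}
    ∃ cu c₀ : ℝ, 0 < cu ∧ 0 < c₀ ∧
      (∀ ⦃α₀ α₁ : ℝ⦄, 0 < α₀ → 0 < α₁ → α₀ + α₁ ≤ c₀ → Thm2TorusWindows d L B₀ (8 * B₀' * (5 * (d : ℝ) * L * B₀)) cu B₁ α₀ α₁) ∧
      ∀ (k : ℕ) (P : ℤ) (η : ℝ), 1 ≤ k → 0 < η → (∃ M : ℤ, P = (L : ℤ) ^ k * M) →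
      ∀ ℓP : LettersAllP (𝔸 := Matrix (Fin N) (Fin N) ℂ) L BG BR B₀'H B₂' B₀ B₀β cB β len cL η k P (specialUnitaryUnits (Fin N)),
        LettersAllPTau (𝔸 := Matrix (Fin N) (Fin N) ℂ) (trCLM (Fin N)) ℓP →
      (∀ m, m ≤ k → SockB9P3 (𝔸 := Matrix (Fin N) (Fin N) ℂ) L B₀ B₀β cB9 β len η m (fun _ => (Set.univ : Set (Site d)))
          (fun m => torusLam (d := d) m) (fun m => torusLamb (d := d) m)) →
      ∀ ⦃α₀ α₁ : ℝ⦄, 0 < α₀ → 0 < α₁ → α₀ + α₁ ≤ c₀ → ∀ U₀ U' : Site d → Fin d → (Matrix (Fin N) (Fin N) ℂ)ˣ,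
        (∀ x κ, U₀ x κ ∈ specialUnitaryUnits (Fin N)) → (∀ x κ, U' x κ ∈ specialUnitaryUnits (Fin N)) →
        (∀ i : Fin d, shiftCfg (P • e i) U₀ = U₀) → (∀ i : Fin d, shiftCfg (P • e i) U' = U') →
        InAk L k η α₀ (fun _ => (Set.univ : Set (Site d))) U₀ → InAk L k η α₀ (fun _ => (Set.univ : Set (Site d))) (U' * U₀) →
        InAx L k (torusLam k) U₀ (U' * U₀) → Hyp135 L k (torusLam k) α₁ U₀ U' →
        Thm2TorusSockets L k P η 0 B₀ (2 * B₀) (8 * B₀' * (5 * (d : ℝ) * L * B₀)) cu B₁ len (specialUnitaryUnits (Fin N)) α₀ α₁ U₀ U' := by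
  letI : CStarAlgebra (Matrix (Fin N) (Fin N) ℂ) := {}
  haveI : Nonempty (Fin N) := ⟨⟨0, Nat.pos_of_ne_zero (NeZero.ne N)⟩⟩
  exact thm2TorusSockets_uniform_of_letters (trCLM (Fin N)) trCLM_mul_comm hd2 hL (H := slUnits N)
    (fun g hg hs => trCLM_mlog_eq_zero_of_mem_slUnits hN hg hs) (fun S hS => expUnit_mem_slUnits hS)
    (avgClosed_specialUnitary_of_le hN d L) specialUnitaryUnits_le_slUnits specialUnitaryUnits_le_unitaryUnits
    (fun lam x hsa htr => by rw [gaugeExp]; exact expUnit_I_smul_mem_specialUnitaryUnits hsa htr)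
    hB₀ hB₀' hB hB₀'H hB₂' hBG hBR hcB9 hcL hfree hB₁

/-- ★ **THEOREM 2 ON THE TORUS FOR `G = SU(N)` (`1 ≤ N ≤ 25`), BOTH HALVES, MEMBER-UNIFORMLY, MODULO THE LETTERS — THE ENDPOINT OF SUB-ROW
«G-B8-T2S»**: `B8Thm2TorusAt.Thm2TorusAt L k P η 0 B₁ B₂ c₁ len (specialUnitaryUnits (Fin N)) (fun _ => True)` with ONE pair `B₂, c₁ > 0` at every
torus member (`k ≥ 1`, `P ∈ Lᵏℤ`, `η > 0`) carrying the [4] letters `LettersAllP … (specialUnitaryUnits (Fin N))`, their `tr`-laws and the b9 socket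
— the input of `B8Thm2SetupTorus.thm2SetupSUAt_of_thm2TorusAt` (`N = 2`, R3's P-V3-A row).  HONEST SCOPE: Theorem 2 on `T_η` for `SU(N)` MODULO THE
[4] LETTERS (displayed hypotheses, v2 binder — laws read at arbitrary arguments; RULING #4's v3 not implemented) and `B₁ > 5dLB₀(1 + 11d²)`,
`5dLB₀ ≥ 2`, `3·(2dL²)·B_G·B_R ≤ B₀′`; `β₀ = 0`; count-neutral — N05 ∕ `stub_PV3A` NOT discharged (its consumer owes the letters); nothing
continuum ∕ ℝ⁴ ∕ OS ∕ mass-gap ∕ Clay: the Yang–Mills mass gap is NOT proved.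
[cite: Balaban1985RegularSpaces, Thm 2 p.83, (1.33)–(1.39) pp.82–83, p.76 («G = SU(N)»), p.77 («Ω_j = T_η»), Thm 4 p.88, Prop. 5 p.94, p.95; Balaban1985Averaging, p.20; Balaban1985BackgroundPropagators, Thms 3.1–3.3 pp.397–399] -/
theorem thm2TorusAt_specialUnitary_of_letters (hN : N ≤ 25) (hd2 : 2 ≤ d) {L : ℕ} (hL : 2 ≤ L)
    {B₀ B₀' B₀'H B₂' BG BR B₀β cB9 cB β cL B₁ : ℝ} {len : Site d → ℝ}
    (hB₀ : 0 < B₀) (hB₀' : 0 < B₀') (hB : 2 ≤ 5 * (d : ℝ) * L * B₀) (hB₀'H : 0 < B₀'H) (hB₂' : 0 ≤ B₂') (hBG : 0 ≤ BG) (hBR : 0 ≤ BR)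
    (hcB9 : 0 < cB9) (hcL : 0 < cL) (hfree : 3 * (2 * (d : ℝ) * (L : ℝ) ^ 2) * BG * BR ≤ B₀')
    (hB₁ : 5 * (d : ℝ) * L * B₀ * (1 + 11 * (d : ℝ) ^ 2) < B₁) :
    letI : CStarAlgebra (Matrix (Fin N) (Fin N) ℂ) := {}
    ∃ B₂ c₁ : ℝ, 0 < B₂ ∧ 0 < c₁ ∧ ∀ (k : ℕ) (P : ℤ) (η : ℝ), 1 ≤ k → 0 < η → (∃ M : ℤ, P = (L : ℤ) ^ k * M) →
      ∀ ℓP : LettersAllP (𝔸 := Matrix (Fin N) (Fin N) ℂ) L BG BR B₀'H B₂' B₀ B₀β cB β len cL η k P (specialUnitaryUnits (Fin N)),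
        LettersAllPTau (𝔸 := Matrix (Fin N) (Fin N) ℂ) (trCLM (Fin N)) ℓP →
      (∀ m, m ≤ k → SockB9P3 (𝔸 := Matrix (Fin N) (Fin N) ℂ) L B₀ B₀β cB9 β len η m (fun _ => (Set.univ : Set (Site d)))
          (fun m => torusLam (d := d) m) (fun m => torusLamb (d := d) m)) →
      Thm2TorusAt L k P η 0 B₁ B₂ c₁ len (specialUnitaryUnits (Fin N)) (fun _ => True) := by
  letI : CStarAlgebra (Matrix (Fin N) (Fin N) ℂ) := {}
  haveI : Nonempty (Fin N) := ⟨⟨0, Nat.pos_of_ne_zero (NeZero.ne N)⟩⟩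
  exact thm2TorusAt_uniform_of_letters (trCLM (Fin N)) trCLM_mul_comm hd2 hL (H := slUnits N)
    (fun g hg hs => trCLM_mlog_eq_zero_of_mem_slUnits hN hg hs) (fun S hS => expUnit_mem_slUnits hS)
    (avgClosed_specialUnitary_of_le hN d L) specialUnitaryUnits_le_slUnits specialUnitaryUnits_le_unitaryUnits
    (fun lam x hsa htr => by rw [gaugeExp]; exact expUnit_I_smul_mem_specialUnitaryUnits hsa htr)
    hB₀ hB₀' hB hB₀'H hB₂' hBG hBR hcB9 hcL hfree hB₁

end SpecialUnitary

#print axioms serverWindows_threshold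
#print axioms thm2TorusSockets_of_lettersAt
#print axioms thm2TorusSockets_uniform_of_letters
#print axioms thm2TorusAt_uniform_of_letters
#print axioms thm2TorusSockets_specialUnitary_of_letters
#print axioms thm2TorusAt_specialUnitary_of_letters

end Literature.MathematicalPhysics.QuantumFieldTheory.Balaban1983to89.B8Thm2TorusAtOfLetters

end
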